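import Mathlib
import Literature.Probability.LatticeModels.ProdBernoulliIndependence
import Literature.Probability.LatticeModels.IsoradialPercolationProofs
import Literature.Probability.Percolation.PercolationProofs
import Literature.Probability.Percolation.Crossings
import Literature.Probability.Percolation.TreeGraphBound
import HarnessLib

/-!
# Few fingers are harmless (hub form): `stub_fewFingersHub`

This file proves `stub_fewFingersHub` ("few fingers are harmless", hub form).

## Statement

Finite weighted graph on `Fin n`, `P = prodBernoulli w` (independent edges), relay set `A`, hub
`a₀ ∈ A`, observer `o ∉ A`, star budget `P(a ↮ a₀) ≤ δ₀` (`a ∈ A`) and observer budget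
`P(o ↮ A) ≤ δ₁`.  The PIONEERS of a configuration `ω` are
`D(ω) = {a ∈ A | ω ∈ openConnIn (Aᶜ ∪ {o, a}) o a}`.  Assuming the spread switch (hypothesis;
proved separately as `stub_spreadSwitch`): for every `d` there are `C, κ > 0` (we take
`C = 2 (d + 1)²`, `κ = 2^{-d}`) such that the event "`o ↮ a₀` and `2 ≤ |D(ω)| ≤ d`" has
probability at most `C (δ₀ + δ₁)^κ`.

## Proof

Put `s = δ₀ + δ₁`, `t = s^{1/2^d}` (so `s = t^{2^d}`; WLOG `s ≤ 1`, else the bound exceeds `1`)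
and the popularity threshold `η = t^{2^{d-1}} = √s`.  A relay point `a` is POPULAR if
`P(a ∈ D, |D| ≤ d) ≥ η` and UNPOPULAR otherwise (`U` = the unpopular points).
* (few popular points) `∑_{a ∈ A} P(a ∈ D, |D| ≤ d) = E[|D| ; |D| ≤ d] ≤ d`, so the number of
  popular points is at most `d / η`; on the event a popular pioneer `a` has `o ↔ a`, `o ↮ a₀`,
  hence `a ↮ a₀`: this part costs `#popular · δ₀ ≤ (d/η) · s = d t^{2^{d-1}} ≤ d t`.
* (levels) Put `T_k = P(D ⊆ U, |D| ≤ k)`.  `T_0 = P(D = ∅) ≤ P(o ↮ A) ≤ δ₁` (the first vertex in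
  `A` of an open `o → A` path is a pioneer).  For `k < d` the parts `{D = S}` over the
  `(k+1)`-subsets `S ⊆ U` are pairwise disjoint, each of mass `≤ η` (pick `a ∈ S`: unpopular),
  and since `D` is monotone the meet `ω ∩ ω'` of two configurations from different parts has
  `D(ω ∩ ω') ⊆ S ∩ S'`, of size `≤ k`, inside `U`: the meets lie in `{D ⊆ U, |D| ≤ k}`.  The
  spread switch gives `T_{k+1} ≤ T_k + η + 2 √T_k`.
* (recursion) With `τ_k = t^{2^{d-k}}` (`τ_{k+1}² = τ_k`, `η ≤ τ_{k+1}`, `τ ≤ 1`) induction gives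
  `T_k ≤ (k+1)² τ_k`, so `T_d ≤ (d+1)² t`.
* (total) The event is covered by `⋃_{a popular} {a ↮ a₀}` and `{D ⊆ U, |D| ≤ d}`, so its mass is
  at most `d t + (d+1)² t ≤ 2 (d+1)² t`.
-/

namespace Summit.CriticalPhenomena.PercolationContinuityZ3.Theorems

open scoped Classical BigOperators Topology
open MeasureTheory Set Filter
open Literature.Probability.LatticeModels (prodBernoulli mem_openConnIn_iff_exists_openWalk)
open Literature.Probability.Percolation (openConn openConnIn openGraph BondConfig
  measurableSet_openConn_holds isUpperSet_openConnIn openConnIn_subset_openConn)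

/-- First entrance of a walk into a vertex set: a walk from `u` to a vertex of `A` has an initial
segment ending at some `a ∈ A` all of whose vertices other than `u` and `a` lie outside `A`.
[folklore] -/
private theorem ffh_exists_walk_firstMem {V : Type*} {G : SimpleGraph V} (A : Set V) {u v : V}
    (p : G.Walk u v) (hv : v ∈ A) :
    ∃ a ∈ A, ∃ q : G.Walk u a, ∀ x ∈ q.support, x ∈ A → x = u ∨ x = a := by
  induction p with
  | @nil u => exact ⟨u, hv, SimpleGraph.Walk.nil, fun x hx _ => Or.inl (by simpa using hx)⟩
  | @cons u u₁ v h p ih =>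
    by_cases hu : u ∈ A
    · exact ⟨u, hu, SimpleGraph.Walk.nil, fun x hx _ => Or.inl (by simpa using hx)⟩
    obtain ⟨a, ha, q, hq⟩ := ih hv
    by_cases hu₁ : u₁ ∈ A
    · refine ⟨u₁, hu₁, SimpleGraph.Walk.cons h SimpleGraph.Walk.nil, fun x hx _ => ?_⟩
      simpa using hx
    · refine ⟨a, ha, SimpleGraph.Walk.cons h q, fun x hx hxA => ?_⟩
      rw [SimpleGraph.Walk.support_cons, List.mem_cons] at hx
      rcases hx with rfl | hx
      · exact Or.inl rfl
      · rcases hq x hx hxA with rfl | rfl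
        · exact absurd hxA hu₁
        · exact Or.inr rfl

/-- **Pioneers exist.** If `o` is joined by an open path to a relay point `a ∈ A`, then some
`a' ∈ A` is a pioneer: `o` is joined to `a'` by an open path all of whose vertices lie in
`Aᶜ ∪ {o, a'}` (take the first vertex of the path lying in `A`). [folklore] -/
private theorem ffh_exists_pioneer {n : ℕ} (A : Finset (Fin n)) (o : Fin n) {a : Fin n}
    {ω : BondConfig (Fin n)} (ha : a ∈ A) (h : ω ∈ openConn o a) :
    ∃ a' ∈ A, ω ∈ openConnIn ((↑A : Set (Fin n))ᶜ ∪ {o, a'}) o a' := by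
  have h' : (openGraph ω).Reachable o a := h
  obtain ⟨p⟩ := h'
  obtain ⟨a', ha', q, hq⟩ := ffh_exists_walk_firstMem (↑A : Set (Fin n)) p (Finset.mem_coe.2 ha)
  refine ⟨a', Finset.mem_coe.1 ha', mem_openConnIn_iff_exists_openWalk.2 ⟨q, fun v hv => ?_⟩⟩
  simp only [Set.mem_union, Set.mem_compl_iff, Finset.mem_coe, Set.mem_insert_iff,
    Set.mem_singleton_iff]
  by_cases hvA : v ∈ A
  · exact Or.inr (hq v hv (Finset.mem_coe.2 hvA))
  · exact Or.inl hvA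

/-- The real recursion behind the level induction: if `0 ≤ t ≤ 1`, `η ≤ t^{2^{d-1}}`,
`T_0 ≤ t^{2^d}` and `T_{k+1} ≤ T_k + η + 2 √T_k` for `k < d`, then
`T_k ≤ (k+1)² t^{2^{d-k}}` for all `k ≤ d`. [folklore] -/
private theorem ffh_recursion (d : ℕ) (t η : ℝ) (T : ℕ → ℝ) (ht0 : 0 ≤ t) (ht1 : t ≤ 1)
    (hη : η ≤ t ^ (2 ^ (d - 1))) (hT0 : T 0 ≤ t ^ (2 ^ d))
    (hrec : ∀ k < d, T (k + 1) ≤ T k + η + 2 * Real.sqrt (T k)) :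
    ∀ k ≤ d, T k ≤ ((k : ℝ) + 1) ^ 2 * t ^ (2 ^ (d - k)) := by
  intro k
  induction k with
  | zero => intro _; simpa using hT0
  | succ k ih =>
    intro hk
    have hk' : k < d := hk
    set τ : ℝ := t ^ (2 ^ (d - (k + 1))) with hτ
    have hτ0 : 0 ≤ τ := pow_nonneg ht0 _
    have hτ1 : τ ≤ 1 := pow_le_one₀ ht0 ht1
    have hpow : t ^ (2 ^ (d - k)) = τ ^ 2 := by
      rw [hτ, ← pow_mul, ← pow_succ, show d - (k + 1) + 1 = d - k by omega]
    have hηle : η ≤ τ :=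
      hη.trans (pow_le_pow_of_le_one ht0 ht1 (Nat.pow_le_pow_right two_pos (by omega)))
    have hTk : T k ≤ (((k : ℝ) + 1) * τ) ^ 2 := by
      have h := ih hk'.le
      rw [hpow] at h
      linarith [h, show ((k : ℝ) + 1) ^ 2 * τ ^ 2 = (((k : ℝ) + 1) * τ) ^ 2 by ring]
    have hsq : Real.sqrt (T k) ≤ ((k : ℝ) + 1) * τ :=
      Real.sqrt_le_iff.2 ⟨by positivity, hTk⟩
    have hTk' : T k ≤ ((k : ℝ) + 1) ^ 2 * τ := by
      refine hTk.trans ?_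
      rw [mul_pow]
      exact mul_le_mul_of_nonneg_left (by nlinarith) (by positivity)
    calc T (k + 1) ≤ T k + η + 2 * Real.sqrt (T k) := hrec k hk'
      _ ≤ ((k : ℝ) + 1) ^ 2 * τ + τ + 2 * (((k : ℝ) + 1) * τ) := by linarith
      _ = (((k + 1 : ℕ) : ℝ) + 1) ^ 2 * τ := by push_cast; ring

/-- Counting pioneers: for any finset-valued map `D` and any finset `A`,
`∑_{a ∈ A} P(a ∈ D, |D| ≤ d) = E[|A ∩ D| ; |D| ≤ d] ≤ d` under a probability measure.
[folklore] -/
private theorem ffh_sum_real_mem_le {n : ℕ} (μ : Measure (BondConfig (Fin n)))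
    [IsProbabilityMeasure μ] (D : BondConfig (Fin n) → Finset (Fin n)) (A : Finset (Fin n))
    (d : ℕ) :
    ∑ a ∈ A, μ.real {ω | a ∈ D ω ∧ (D ω).card ≤ d} ≤ d := by
  set S : Fin n → Set (BondConfig (Fin n)) := fun a => {ω | a ∈ D ω ∧ (D ω).card ≤ d} with hS
  have hint : ∀ a ∈ A, Integrable ((S a).indicator fun _ => (1 : ℝ)) μ :=
    fun a _ => (integrable_const (1 : ℝ)).indicator MeasurableSet.of_discrete
  have h1 : ∀ a ∈ A, μ.real (S a) = ∫ ω, (S a).indicator (fun _ => (1 : ℝ)) ω ∂μ := by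
    intro a _
    rw [integral_indicator_const (1 : ℝ) MeasurableSet.of_discrete, smul_eq_mul, mul_one]
  change ∑ a ∈ A, μ.real (S a) ≤ d
  rw [Finset.sum_congr rfl h1, ← integral_finsetSum A hint]
  calc ∫ ω, ∑ a ∈ A, (S a).indicator (fun _ => (1 : ℝ)) ω ∂μ ≤ ∫ _, (d : ℝ) ∂μ := by
        refine integral_mono (integrable_finsetSum A hint) (integrable_const _) fun ω => ?_
        change ∑ a ∈ A, (S a).indicator (fun _ => (1 : ℝ)) ω ≤ d
        by_cases hc : (D ω).card ≤ d
        · have hterm : ∀ a ∈ A, (S a).indicator (fun _ => (1 : ℝ)) ω =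
              if a ∈ D ω then (1 : ℝ) else 0 := by
            intro a _
            by_cases ha : a ∈ D ω
            · rw [if_pos ha, Set.indicator_of_mem (show ω ∈ S a from ⟨ha, hc⟩)]
            · rw [if_neg ha, Set.indicator_of_notMem (show ω ∉ S a from fun h => ha h.1)]
          rw [Finset.sum_congr rfl hterm, Finset.sum_boole]
          have hle : (A.filter fun a => a ∈ D ω).card ≤ d :=
            (Finset.card_le_card fun a ha => (Finset.mem_filter.1 ha).2).trans hc
          exact_mod_cast hle
        · rw [Finset.sum_eq_zero fun a _ =>
            Set.indicator_of_notMem (show ω ∉ S a from fun h => hc h.2) _]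
          positivity
    _ = d := by simp

/-- **One level of the finger count.**  Let `D` be a monotone finset-valued map on bond
configurations, `U` a set of "unpopular" points (`P(a ∈ D, |D| ≤ d) ≤ η` for `a ∈ U`, `0 ≤ η`)
and `k < d`.  The parts `{D = S}` over the `(k+1)`-subsets `S ⊆ U` are pairwise disjoint, each
of mass `≤ η`, and the meet of two configurations from different parts has its `D` inside
`S ∩ S'` (`|S ∩ S'| ≤ k`, `⊆ U`); so the spread switch (hypothesis `hSS`) gives
`P(D ⊆ U, |D| ≤ k+1) ≤ P(D ⊆ U, |D| ≤ k) + η + 2 √P(D ⊆ U, |D| ≤ k)`. [folklore] -/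
private theorem ffh_level {n : ℕ} (w : Sym2 (Fin n) → unitInterval)
    (hSS : ∀ (L : ℕ) (Q : Fin L → Set (BondConfig (Fin n))) (Z : Set (BondConfig (Fin n)))
      (m : ℝ), 0 ≤ m → (∀ i j, i ≠ j → Disjoint (Q i) (Q j)) →
      (∀ i j, i ≠ j → ∀ ω ∈ Q i, ∀ ω' ∈ Q j, ω ∩ ω' ∈ Z) →
      (∀ i, (prodBernoulli w).real (Q i) ≤ m) →
      ∑ i, (prodBernoulli w).real (Q i) ≤ m + 2 * Real.sqrt ((prodBernoulli w).real Z))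
    (D : BondConfig (Fin n) → Finset (Fin n)) (hDmono : ∀ ω ω', ω ⊆ ω' → D ω ⊆ D ω')
    (U : Finset (Fin n)) (η : ℝ) (hη : 0 ≤ η) (d k : ℕ) (hk : k < d)
    (hU : ∀ a ∈ U, (prodBernoulli w).real {ω | a ∈ D ω ∧ (D ω).card ≤ d} ≤ η) :
    (prodBernoulli w).real {ω | D ω ⊆ U ∧ (D ω).card ≤ k + 1} ≤
      (prodBernoulli w).real {ω | D ω ⊆ U ∧ (D ω).card ≤ k} + η +
        2 * Real.sqrt ((prodBernoulli w).real {ω | D ω ⊆ U ∧ (D ω).card ≤ k}) := by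
  set μ := prodBernoulli w with hμ
  set F : Finset (Finset (Fin n)) := U.powersetCard (k + 1) with hF
  set e : Fin F.card ≃ {S // S ∈ F} := F.equivFin.symm with he
  set Q : Fin F.card → Set (BondConfig (Fin n)) :=
    fun i => {ω | D ω = (e i : Finset (Fin n))} with hQ
  set Z : Set (BondConfig (Fin n)) := {ω | D ω ⊆ U ∧ (D ω).card ≤ k} with hZ
  have hmemF : ∀ i, (e i : Finset (Fin n)) ⊆ U ∧ (e i : Finset (Fin n)).card = k + 1 :=
    fun i => Finset.mem_powersetCard.1 (e i).2
  have hdisj : ∀ i j, i ≠ j → Disjoint (Q i) (Q j) := by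
    intro i j hij
    refine Set.disjoint_left.2 fun ω hi hj => hij (e.injective (Subtype.ext ?_))
    exact (show D ω = _ from hi).symm.trans hj
  have hmeet : ∀ i j, i ≠ j → ∀ ω ∈ Q i, ∀ ω' ∈ Q j, ω ∩ ω' ∈ Z := by
    intro i j hij ω hω ω' hω'
    have hω1 : D ω = (e i : Finset (Fin n)) := hω
    have hω2 : D ω' = (e j : Finset (Fin n)) := hω'
    have hsub : D (ω ∩ ω') ⊆ (e i : Finset (Fin n)) ∩ (e j : Finset (Fin n)) :=
      Finset.subset_inter (hω1 ▸ hDmono _ _ Set.inter_subset_left)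
        (hω2 ▸ hDmono _ _ Set.inter_subset_right)
    refine ⟨hsub.trans (Finset.inter_subset_left.trans (hmemF i).1), ?_⟩
    refine (Finset.card_le_card hsub).trans (Nat.lt_succ_iff.1 (lt_of_not_ge fun hle => hij ?_))
    have h1 : (e i : Finset (Fin n)) ∩ (e j : Finset (Fin n)) = e i :=
      Finset.eq_of_subset_of_card_le Finset.inter_subset_left ((hmemF i).2.trans_le hle)
    have h2 : (e i : Finset (Fin n)) ∩ (e j : Finset (Fin n)) = e j :=
      Finset.eq_of_subset_of_card_le Finset.inter_subset_right ((hmemF j).2.trans_le hle)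
    exact e.injective (Subtype.ext (h1.symm.trans h2))
  have hQm : ∀ i, μ.real (Q i) ≤ η := by
    intro i
    obtain ⟨a, ha⟩ : (e i : Finset (Fin n)).Nonempty :=
      Finset.card_pos.1 (by rw [(hmemF i).2]; omega)
    refine le_trans (measureReal_mono fun ω hω => ?_) (hU a ((hmemF i).1 ha))
    have hω1 : D ω = (e i : Finset (Fin n)) := hω
    refine ⟨hω1 ▸ ha, ?_⟩
    rw [hω1, (hmemF i).2]
    omega
  have hsum := hSS F.card Q Z η hη hdisj hmeet hQm
  have hcov : {ω | D ω ⊆ U ∧ (D ω).card ≤ k + 1} ⊆ Z ∪ ⋃ i, Q i := by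
    intro ω hω
    rcases Nat.lt_or_ge (D ω).card (k + 1) with hlt | hge
    · exact Or.inl ⟨hω.1, Nat.lt_succ_iff.1 hlt⟩
    · have hmem : D ω ∈ F := Finset.mem_powersetCard.2 ⟨hω.1, le_antisymm hω.2 hge⟩
      refine Or.inr (Set.mem_iUnion.2 ⟨e.symm ⟨D ω, hmem⟩, ?_⟩)
      change D ω = (e (e.symm ⟨D ω, hmem⟩) : Finset (Fin n))
      rw [Equiv.apply_symm_apply]
  calc μ.real {ω | D ω ⊆ U ∧ (D ω).card ≤ k + 1} ≤ μ.real (Z ∪ ⋃ i, Q i) :=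
        measureReal_mono hcov
    _ ≤ μ.real Z + μ.real (⋃ i, Q i) := measureReal_union_le _ _
    _ ≤ μ.real Z + ∑ i, μ.real (Q i) := by
        have h := measureReal_iUnion_fintype_le (μ := μ) Q
        linarith
    _ ≤ μ.real Z + (η + 2 * Real.sqrt (μ.real Z)) := by linarith
    _ = μ.real Z + η + 2 * Real.sqrt (μ.real Z) := by ring

/-- **Few fingers are harmless, hub form.**  Assuming the spread
switch (hypothesis): for every `d` there are `C, κ > 0` (here `C = 2 (d+1)²`, `κ = 2^{-d}`) such
that for a hub `a₀ ∈ A`, an observer `o ∉ A`, star budget `P(a ↮ a₀) ≤ δ₀ (a ∈ A)` and observer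
budget `P(o ↮ A) ≤ δ₁`, the event "`o ↮ a₀` and `o` has between `2` and `d` pioneers" has
probability `≤ C (δ₀ + δ₁)^κ`, where the pioneers of `ω` are
`D(ω) = {a ∈ A | ω ∈ openConnIn (Aᶜ ∪ {o, a}) o a}`.  Proof: popularity threshold
`η = (δ₀ + δ₁)^{1/2}`; popular pioneers are charged to their own budgets (`≤ (d/η) δ₀`); the parts
`{D = S}` over all-unpopular `k`-sets are controlled level by level by the spread switch (`D` is
monotone, so cross meets drop a level), each level costing one square root; see the module
docstring. [folklore] -/
theorem stub_fewFingersHub :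
    (∀ (n L : ℕ) (w : Sym2 (Fin n) → unitInterval) (Q : Fin L → Set (BondConfig (Fin n)))
      (Z : Set (BondConfig (Fin n))) (m : ℝ),
      0 ≤ m →
      (∀ i j, i ≠ j → Disjoint (Q i) (Q j)) →
      (∀ i j, i ≠ j → ∀ ω ∈ Q i, ∀ ω' ∈ Q j, ω ∩ ω' ∈ Z) →
      (∀ i, (prodBernoulli w).real (Q i) ≤ m) →
      ∑ i, (prodBernoulli w).real (Q i) ≤ m + 2 * Real.sqrt ((prodBernoulli w).real Z)) →
    ∀ d : ℕ, ∃ C κ : ℝ, 0 < C ∧ 0 < κ ∧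
      ∀ (n : ℕ) (w : Sym2 (Fin n) → unitInterval) (A : Finset (Fin n)) (o a₀ : Fin n) (δ₀ δ₁ : ℝ),
        a₀ ∈ A → o ∉ A →
        (∀ a ∈ A, (prodBernoulli w).real (openConn a a₀)ᶜ ≤ δ₀) →
        (prodBernoulli w).real (⋃ a ∈ A, openConn o a)ᶜ ≤ δ₁ →
        (prodBernoulli w).real {ω : BondConfig (Fin n) | ω ∉ openConn o a₀ ∧
            2 ≤ (A.filter fun a => ω ∈ openConnIn ((↑A : Set (Fin n))ᶜ ∪ {o, a}) o a).card ∧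
            (A.filter fun a => ω ∈ openConnIn ((↑A : Set (Fin n))ᶜ ∪ {o, a}) o a).card ≤ d}
          ≤ C * (δ₀ + δ₁) ^ κ := by
  intro hSS d
  refine ⟨2 * ((d : ℝ) + 1) ^ 2, 1 / 2 ^ d, by positivity, by positivity, ?_⟩
  intro n w A o a₀ δ₀ δ₁ ha₀ _ho hδ₀ hδ₁
  set μ := prodBernoulli w with hμ
  -- the pioneer set `D ω`: monotone, nonempty as soon as `o ↔ A`
  set D : BondConfig (Fin n) → Finset (Fin n) :=
    fun ω => A.filter fun a => ω ∈ openConnIn ((↑A : Set (Fin n))ᶜ ∪ {o, a}) o a with hD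
  have hDmem : ∀ {ω : BondConfig (Fin n)} {a : Fin n},
      a ∈ D ω ↔ a ∈ A ∧ ω ∈ openConnIn ((↑A : Set (Fin n))ᶜ ∪ {o, a}) o a :=
    fun {ω a} => Finset.mem_filter
  have hDmono : ∀ ω ω' : BondConfig (Fin n), ω ⊆ ω' → D ω ⊆ D ω' := by
    intro ω ω' hle a ha
    rw [hDmem] at ha ⊢
    exact ⟨ha.1, isUpperSet_openConnIn _ o a hle ha.2⟩
  have hDne : ∀ {ω : BondConfig (Fin n)} {a : Fin n}, a ∈ A → ω ∈ openConn o a →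
      (D ω).Nonempty := by
    intro ω a ha h
    obtain ⟨a', ha', h'⟩ := ffh_exists_pioneer A o ha h
    exact ⟨a', hDmem.2 ⟨ha', h'⟩⟩
  -- parameters `s = δ₀ + δ₁`, `t = s ^ (1 / 2^d)`
  set s : ℝ := δ₀ + δ₁ with hs
  have hδ₀0 : 0 ≤ δ₀ := le_trans measureReal_nonneg (hδ₀ a₀ ha₀)
  have hδ₁0 : 0 ≤ δ₁ := le_trans measureReal_nonneg hδ₁
  have hs0 : 0 ≤ s := add_nonneg hδ₀0 hδ₁0
  set t : ℝ := s ^ ((1 : ℝ) / 2 ^ d) with ht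
  have ht0 : 0 ≤ t := Real.rpow_nonneg hs0 _
  have hts : t ^ (2 ^ d) = s := by
    rw [ht, ← Real.rpow_mul_natCast hs0, Nat.cast_pow, Nat.cast_ofNat, one_div,
      inv_mul_cancel₀ (by positivity), Real.rpow_one]
  -- degenerate cases: `d < 2` (empty event) and `1 < s` (the bound exceeds one)
  rcases Nat.lt_or_ge d 2 with hd | hd
  · refine (measureReal_mono (s₂ := (∅ : Set (BondConfig (Fin n)))) ?_).trans ?_
    · rintro ω ⟨-, h2, h3⟩
      exact absurd (h2.trans h3) (by omega)
    · rw [measureReal_empty]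
      positivity
  rcases lt_or_ge 1 s with hs1 | hs1
  · have ht1 : 1 ≤ t := Real.one_le_rpow hs1.le (by positivity)
    exact measureReal_le_one.trans
      (by nlinarith [ht1, sq_nonneg (d : ℝ), (Nat.cast_nonneg d : (0 : ℝ) ≤ d)])
  have ht1 : t ≤ 1 := Real.rpow_le_one hs0 hs1 (by positivity)
  -- popularity threshold `η = t ^ (2^(d-1)) = √s`; unpopular points `U`, popular points `P`
  set η : ℝ := t ^ (2 ^ (d - 1)) with hη
  have hη0 : 0 ≤ η := pow_nonneg ht0 _
  have hηts : η * t ^ (2 ^ (d - 1)) = s := by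
    rw [← hts, hη, ← pow_add, ← two_mul, ← pow_succ', Nat.sub_add_cancel (by omega)]
  set U : Finset (Fin n) :=
    A.filter fun a => μ.real {ω | a ∈ D ω ∧ (D ω).card ≤ d} < η with hU
  set P : Finset (Fin n) :=
    A.filter fun a => η ≤ μ.real {ω | a ∈ D ω ∧ (D ω).card ≤ d} with hP
  -- few popular points: `#P · η ≤ d`, so the popular charge is `#P · δ₀ ≤ d t`
  have hPη : (P.card : ℝ) * η ≤ d := by
    calc (P.card : ℝ) * η = ∑ _a ∈ P, η := by rw [Finset.sum_const, nsmul_eq_mul]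
      _ ≤ ∑ a ∈ P, μ.real {ω | a ∈ D ω ∧ (D ω).card ≤ d} :=
          Finset.sum_le_sum fun a ha => (Finset.mem_filter.1 ha).2
      _ ≤ ∑ a ∈ A, μ.real {ω | a ∈ D ω ∧ (D ω).card ≤ d} :=
          Finset.sum_le_sum_of_subset_of_nonneg (Finset.filter_subset _ _)
            fun _ _ _ => measureReal_nonneg
      _ ≤ d := ffh_sum_real_mem_le μ D A d
  have hPδ : (P.card : ℝ) * δ₀ ≤ d * t := by
    have h1 : δ₀ ≤ η * t := by
      calc δ₀ ≤ s := by linarith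
        _ = η * t ^ (2 ^ (d - 1)) := hηts.symm
        _ ≤ η * t := mul_le_mul_of_nonneg_left (pow_le_of_le_one ht0 ht1 (by positivity)) hη0
    calc (P.card : ℝ) * δ₀ ≤ P.card * (η * t) := mul_le_mul_of_nonneg_left h1 (Nat.cast_nonneg _)
      _ = P.card * η * t := by ring
      _ ≤ d * t := mul_le_mul_of_nonneg_right hPη ht0
  -- the all-unpopular levels `T k = P(D ⊆ U, |D| ≤ k)`
  set T : ℕ → ℝ := fun k => μ.real {ω | D ω ⊆ U ∧ (D ω).card ≤ k} with hT
  have hT0 : T 0 ≤ t ^ (2 ^ d) := by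
    rw [hts]
    calc T 0 ≤ μ.real (⋃ a ∈ A, openConn o a)ᶜ := by
          refine measureReal_mono fun ω hω => ?_
          rw [Set.mem_compl_iff, Set.mem_iUnion₂]
          rintro ⟨a, ha, h⟩
          exact (hDne ha h).ne_empty (Finset.card_eq_zero.1 (Nat.le_zero.1 hω.2))
      _ ≤ δ₁ := hδ₁
      _ ≤ s := by linarith
  have hrec : ∀ k < d, T (k + 1) ≤ T k + η + 2 * Real.sqrt (T k) := fun k hk =>
    ffh_level w (fun L => hSS n L w) D hDmono U η hη0 d k hk fun a ha =>
      (Finset.mem_filter.1 ha).2.le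
  have hTd : T d ≤ ((d : ℝ) + 1) ^ 2 * t := by
    have h := ffh_recursion d t η T ht0 ht1 le_rfl hT0 hrec d le_rfl
    rwa [Nat.sub_self, pow_zero, pow_one] at h
  -- the event is covered by the popular pioneers' failures and the all-unpopular levels
  have hcov : {ω : BondConfig (Fin n) | ω ∉ openConn o a₀ ∧ 2 ≤ (D ω).card ∧ (D ω).card ≤ d} ⊆
      (⋃ a ∈ P, (openConn a a₀)ᶜ) ∪ {ω | D ω ⊆ U ∧ (D ω).card ≤ d} := by
    rintro ω ⟨h0, -, h2⟩
    by_cases hDU : D ω ⊆ U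
    · exact Or.inr ⟨hDU, h2⟩
    · obtain ⟨a, haD, haU⟩ := Finset.not_subset.1 hDU
      have haA : a ∈ A := (hDmem.1 haD).1
      have haP : a ∈ P := Finset.mem_filter.2
        ⟨haA, not_lt.1 fun hlt => haU (Finset.mem_filter.2 ⟨haA, hlt⟩)⟩
      have hoa : (openGraph ω).Reachable o a :=
        openConnIn_subset_openConn _ o a (hDmem.1 haD).2
      exact Or.inl (Set.mem_iUnion₂.2 ⟨a, haP, fun h => h0 (hoa.trans h)⟩)
  calc μ.real {ω : BondConfig (Fin n) | ω ∉ openConn o a₀ ∧ 2 ≤ (D ω).card ∧ (D ω).card ≤ d}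
      ≤ μ.real ((⋃ a ∈ P, (openConn a a₀)ᶜ) ∪ {ω | D ω ⊆ U ∧ (D ω).card ≤ d}) :=
        measureReal_mono hcov
    _ ≤ μ.real (⋃ a ∈ P, (openConn a a₀)ᶜ) + T d := measureReal_union_le _ _
    _ ≤ (∑ a ∈ P, μ.real (openConn a a₀)ᶜ) + T d := by
        have h := measureReal_biUnion_finset_le (μ := μ) P fun a => (openConn a a₀)ᶜ
        linarith
    _ ≤ (∑ _a ∈ P, δ₀) + ((d : ℝ) + 1) ^ 2 * t := by
        have h := Finset.sum_le_sum fun a (ha : a ∈ P) => hδ₀ a (Finset.mem_filter.1 ha).1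
        linarith
    _ = P.card * δ₀ + ((d : ℝ) + 1) ^ 2 * t := by rw [Finset.sum_const, nsmul_eq_mul]
    _ ≤ d * t + ((d : ℝ) + 1) ^ 2 * t := by linarith
    _ ≤ 2 * ((d : ℝ) + 1) ^ 2 * t := by
        nlinarith [mul_nonneg (sq_nonneg (d : ℝ)) ht0, mul_nonneg (Nat.cast_nonneg d) ht0]

end Summit.CriticalPhenomena.PercolationContinuityZ3.Theorems
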